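import Mathlib
import Summits.HodgeConjecture.HodgeConjecture.Theorems.PadicSemiregularLiftHodgeAbelianVarietiesCMPivotConverseHolds
import Summits.HodgeConjecture.HodgeConjecture.Theorems.PadicSemiregularLiftHodgeAbelianVarietiesAndreNonrealEigenvalues
import Summits.HodgeConjecture.HodgeConjecture.Theorems.PadicSemiregularLiftHodgeAbelianVarietiesAndreEigenbasis
import Summits.HodgeConjecture.HodgeConjecture.Theorems.PadicSemiregularLiftHodgeAbelianVarietiesAndreField
import Summits.HodgeConjecture.HodgeConjecture.Theorems.PadicSemiregularLiftHodgeAbelianVarietiesAndreFiniteBiproducts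
import Summits.HodgeConjecture.HodgeConjecture.Theorems.PadicSemiregularLiftHodgeAbelianVarietiesAndreLineBasis
import Summits.HodgeConjecture.HodgeConjecture.Theorems.PadicSemiregularLiftHodgeAbelianVarietiesAndreIdempotents
import Summits.HodgeConjecture.HodgeConjecture.Theorems.PadicSemiregularLiftHodgeAbelianVarietiesAndreWedgeBasis
import Summits.HodgeConjecture.HodgeConjecture.Theorems.PadicSemiregularLiftHodgeAbelianVarietiesAndreInterpolation
import Summits.HodgeConjecture.HodgeConjecture.Theorems.PadicSemiregularLiftHodgeAbelianVarietiesAndreSymmetricOperators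
import Summits.HodgeConjecture.HodgeConjecture.Theorems.PadicSemiregularLiftHodgeAbelianVarietiesAndreEsymmCriterion
import Summits.HodgeConjecture.HodgeConjecture.Theorems.PadicSemiregularLiftHodgeAbelianVarietiesAndreMaskedComponent
import Summits.HodgeConjecture.HodgeConjecture.Theorems.PadicSemiregularLiftHodgeAbelianVarietiesAndreKeyIdentity
import Summits.HodgeConjecture.HodgeConjecture.Theorems.PadicSemiregularLiftHodgeAbelianVarietiesAndreIdempotentSplit
import Summits.HodgeConjecture.HodgeConjecture.Theorems.PadicSemiregularLiftHodgeAbelianVarietiesAndreGenericShift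
import Summits.HodgeConjecture.HodgeConjecture.Theorems.PadicSemiregularLiftHodgeAbelianVarietiesAndreTargets

/-!
# Crux `HodgeAbelianVarieties` (stmt-HodgeConjecture-1333), line `cm-pivot-andre` — André with CM targets, module L5b: the assembly

`andre_main`: for a complex abelian variety `A` with a CM subalgebra (crux typing), `0 < p`, `2p ≤ 2 dim A`, and a
rational class `c ∈ H²ᵖ(A(ℂ); ℂ)` of Hodge type `(p,p)`, André's decomposition `c = Σ_α f_α^* t_α` with CM targets of
Weil type, in the EXACT shape of the registered stub `AndreSplitWeilCM` of `Lines/cm_pivot_andre.lean` (the stub file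
adds only the degenerate case `2p > 2 dim A`, where `H²ᵖ = 0`). Assembly of the landed modules
W1–W10, L1–L4, L5a along `work/andre/PLAN.md`: `ψ` and its eigenvalues `μ` from the CM typing bridge, eigenbasis and
rational characteristic polynomial (L5a), field data (L1), `B = ⨁_{Fin n} A` (W1) with its line basis, `X = diag ψ`,
`Y = θ` (L2a), idempotents `u_α` (L2b), wedge basis (L3a), symmetric-function operators (W6, L3b) and the criterion (W7),
the single-embedding component `(π^* c)_D` — rational and `(p,p)` (W10) — with `ι₀^* (π^* c)_D = n • c` (L3e), its
splitting along the `u_α` (L3f), a generic CM endomorphism `X + t Y` (W9), and the targets `im u_α` (L4, using W2, W8).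
-/

set_option linter.dupNamespace false

noncomputable section

namespace Summit.HodgeConjecture.HodgeConjecture.Theorems.HodgeAbelianVarieties.CMPivotAndre

open CategoryTheory CategoryTheory.Limits
open Literature.AlgebraicTopology.SingularHomology
open Literature.AlgebraicGeometry Literature.AlgebraicGeometry.Motives Literature.AlgebraicGeometry.HodgeTheory
open Literature.AlgebraicGeometry.Motives.AbelianVariety

/-- `IsCMSub[A]` — the CM hypothesis of the item VERBATIM: `End⁰(A) = ℚ ⊗ End A` contains a commutative reduced
`ℚ`-subalgebra of dimension `2 · dim A`. Local notation only. -/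
local notation3 (prettyPrint := false) "IsCMSub[" A "]" =>
  ∃ S : Subalgebra ℚ (AbelianVariety.endAlgebra A), IsReduced ↥S ∧ (∀ x ∈ S, ∀ y ∈ S, x * y = y * x) ∧
    Module.finrank ℚ ↥S = 2 * AbelianVariety.dim A

/-- **André's decomposition with CM targets, main case `2p ≤ 2 dim A`.** For `A` with a CM subalgebra, `0 < p`,
`2p ≤ 2 dim A` and a rational `(p,p)`-class `c ∈ H²ᵖ(A(ℂ); ℂ)`: finitely many abelian varieties `Bᵢ` each with a CM
subalgebra, homomorphisms `fᵢ : A ⟶ Bᵢ`, endomorphisms `ψᵢ` with non-real eigenvalues whose eigenspaces on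
`H¹(Bᵢ(ℂ); ℂ)` exhaust and have dimension `2p`, rational `(p,p)`-classes `tᵢ` in the Weil eigen-span of `ψᵢ`, and
`c = Σ fᵢ^* tᵢ` (`Bᵢ = im u_α ⊆ A ⊗ O_E`, `E = ℚ(eigenvalues of a CM endomorphism)`). [cite: Andre1992HodgeCM, Théorème]
[cite: Deligne1982HodgeCycles, §4 (4.3)–(4.4) and endnote 18] -/
theorem andre_main : ∀ (A : Literature.AlgebraicGeometry.Motives.AbelianVariety ℂ) (p : ℕ), 0 < p → 2 * p ≤ 2 * A.dim → (∃ S : Subalgebra ℚ (Literature.AlgebraicGeometry.Motives.AbelianVariety.endAlgebra A), IsReduced ↥S ∧ (∀ x ∈ S, ∀ y ∈ S, x * y = y * x) ∧ Module.finrank ℚ ↥S = 2 * Literature.AlgebraicGeometry.Motives.AbelianVariety.dim A) → ∀ c : Literature.AlgebraicGeometry.HodgeTheory.complexBetti A.X (2 * p), Literature.AlgebraicGeometry.HodgeTheory.IsRationalClass c → Literature.AlgebraicGeometry.HodgeTheory.IsOfHodgeType A.dim A.X (2 * p) p p c → ∃ (m : ℕ) (B : Fin m → Literature.AlgebraicGeometry.Motives.AbelianVariety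 ℂ) (f : ∀ i, A ⟶ B i) (ψ : ∀ i, B i ⟶ B i) (S : Fin m → Finset ℂ) (t : ∀ i, Literature.AlgebraicGeometry.HodgeTheory.complexBetti (B i).X (2 * p)), (∀ i, ∃ S' : Subalgebra ℚ (Literature.AlgebraicGeometry.Motives.AbelianVariety.endAlgebra (B i)), IsReduced ↥S' ∧ (∀ x ∈ S', ∀ y ∈ S', x * y = y * x) ∧ Module.finrank ℚ ↥S' = 2 * Literature.AlgebraicGeometry.Motives.AbelianVariety.dim (B i)) ∧ (∀ i, ∀ μ ∈ S i, μ.im ≠ 0) ∧ (∀ i, (⨆ μ ∈ S i, Module.End.eigenspace (Literature.AlgebraicGeometry.HodgeTheory.complexBetti.map (ψ i).hom.hom.hom 1).hom μ) = ⊤) ∧ (∀ i, ∀ μ ∈ S i, Module.finrank ℂ (Module.End.eigenspace (Literature.AlgebraicGeometry.HodgeTheory.complexBetti.map (ψ i).hom.hom.hom 1).hom μ) = 2 * p) ∧ (∀ i, Literature.AlgebraicGeometry.HodgeTheory.IsRationalClass (t i)) ∧ (∀ i, Literature.AlgebraicGeometry.HodgeTheory.IsOfHodgeType (B i).dim (B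 i).X (2 * p) p p (t i)) ∧ (∀ i, t i ∈ ⨆ μ ∈ S i, Literature.AlgebraicGeometry.HodgeTheory.pullbackEigenclasses (B i) (ψ i) (2 * p) (fun x y => ((x : ℂ) + (y : ℂ) * μ) ^ (2 * p))) ∧ c = ∑ i, Literature.AlgebraicGeometry.HodgeTheory.complexBetti.map (f i).hom.hom.hom (2 * p) (t i) := by
  intro A p hp hpg hCM c hc hh
  classical
  have hd : 0 < 2 * p := by omega
  have hN : 0 < 2 * A.dim := by omega
  have hA : IsSmoothProjective A.dim A.X := AbelianVariety.isSmoothProjective_holds (A := A)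
  -- the CM endomorphism of `A`, its eigenbasis, non-real eigenvalues and rational characteristic polynomial
  obtain ⟨ψA, μ, hμinj, hμev⟩ := CMPivot.stub_isCM_of_cmSubalgebra A hCM
  obtain ⟨v, hv, m, hm⟩ := exists_eigenbasis_charpoly A ψA μ hμinj hμev
  have hμim : ∀ i, (μ i).im ≠ 0 := im_ne_zero_of_hasEigenvalue_of_injective A ψA μ hμinj hμev
  -- field data
  obtain ⟨n, bcoef, ρ, e, cc, hn, hρinj, hρim, hfρ, hpow, hkey⟩ := exists_andreFieldData μ hN hμinj hμim ⟨m, hm⟩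
  choose pz hpz using hpow
  -- `B = ⨁_{Fin n} A`
  haveI : HasFiniteBiproducts (Literature.AlgebraicGeometry.Motives.AbelianVariety ℂ) := hasFiniteBiproducts_abelianVariety
  let B : Literature.AlgebraicGeometry.Motives.AbelianVariety ℂ := ⨁ (fun _ : Fin n => A)
  let π : Fin n → (B ⟶ A) := fun i => biproduct.π (fun _ : Fin n => A) i
  let ι : Fin n → (A ⟶ B) := fun i => biproduct.ι (fun _ : Fin n => A) i
  have hιπ : ∀ i j : Fin n, ι i ≫ π j = if i = j then 𝟙 A else 0 := by
    intro i j
    by_cases h : i = j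
    · subst h; rw [if_pos rfl]; exact biproduct.ι_π_self _ _
    · rw [if_neg h]; exact biproduct.ι_π_ne _ h
  have htot : ∑ i, π i ≫ ι i = 𝟙 B := biproduct.total
  have hB : IsSmoothProjective B.dim B.X := AbelianVariety.isSmoothProjective_holds (A := B)
  -- the line basis, the idempotents, the wedge basis, the operators
  obtain ⟨X, Y, 𝔅, -, hX𝔅, hY𝔅, hι𝔅, hπ𝔅, -⟩ :=
    exists_andreLineBasis A B π ι hn hιπ htot ψA μ v hv bcoef ρ hρinj hfρ pz hpz
  obtain ⟨Nd, u, hNd, hu𝔅, huX, huY, -, hudim⟩ := exists_andreIdempotents B X Y 𝔅 μ ρ hX𝔅 hY𝔅 e cc hkey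
  obtain ⟨Bw, hBw⟩ := exists_andreWedgeBasis (2 * p) B 𝔅
  obtain ⟨Vint, hVint⟩ := exists_coeff_interpolation (2 * p)
  obtain ⟨R, hRrat, hRhodge, hReig⟩ := exists_andreSymmetricOperators (2 * p) B Y Vint hVint
  have hcrit : ∀ M : Multiset ℂ, M.card = 2 * p → ((∀ k : ℕ, k ≤ 2 * p →
      ((2 * p : ℕ) : ℂ) ^ k * M.esymm k = ((2 * p).choose k : ℂ) * M.esymm 1 ^ k) ↔ ∃ r : ℂ, M = Multiset.replicate (2 * p) r) :=
    fun M hM => esymm_power_criterion (2 * p) M hM hd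
  -- the class `y = π^* c` and its single-embedding component `yD`
  let πp : B ⟶ A := ∑ i : Fin n, pz i • π i
  let ι₀ : A ⟶ B := ι ⟨0, hn⟩
  let y : complexBetti B.X (2 * p) := complexBetti.map πp.hom.hom.hom (2 * p) c
  have hyrat : IsRationalClass y := hc.pullback _
  have hyhodge : IsOfHodgeType B.dim B.X (2 * p) p p y := hh.map_of_isSmoothProjective hB hA _
  let MS : Set.powersetCard (Fin (2 * A.dim) × Fin n) (2 * p) → Multiset ℂ := fun S =>
    ((S : Finset (Fin (2 * A.dim) × Fin n)).val.map fun i => ρ i.2)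
  let qv : Fin (2 * p + 1) → Set.powersetCard (Fin (2 * A.dim) × Fin n) (2 * p) → ℂ := fun r S =>
    ((2 * p : ℕ) : ℂ) ^ (r : ℕ) * (((S : Finset (Fin (2 * A.dim) × Fin n)).val.map fun i => ρ i.2).esymm r) -
      ((2 * p).choose r : ℂ) * (((S : Finset (Fin (2 * A.dim) × Fin n)).val.map fun i => ρ i.2).esymm 1) ^ (r : ℕ)
  let F : Finset (Set.powersetCard (Fin (2 * A.dim) × Fin n) (2 * p)) :=
    Finset.univ.filter fun S : Set.powersetCard (Fin (2 * A.dim) × Fin n) (2 * p) => ∀ k : Fin (2 * p + 1),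
      ((2 * p : ℕ) : ℂ) ^ (k : ℕ) * (((S : Finset (Fin (2 * A.dim) × Fin n)).val.map fun i => ρ i.2).esymm k) -
        ((2 * p).choose k : ℂ) * (((S : Finset (Fin (2 * A.dim) × Fin n)).val.map fun i => ρ i.2).esymm 1) ^ (k : ℕ) = 0
  let yD : complexBetti B.X (2 * p) := ∑ S ∈ F, Bw.repr y S • Bw S
  -- `yD` is rational and of type `(p,p)`: the operators `R_k` are diagonal on `Bw` with eigenvalues `qv`
  have hMScard : ∀ S, (MS S).card = 2 * p := fun S => by
    simp only [MS, Multiset.card_map, Finset.card_val, Set.powersetCard.card_eq]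
  have hGY : ∀ (x : ℕ) (i : Fin (2 * A.dim) × Fin n),
      complexBetti.map ((x • 𝟙 B + Y) : B ⟶ B).hom.hom.hom 1 (𝔅 i) = ((x : ℂ) + ρ i.2) • 𝔅 i := by
    rintro x ⟨l, s⟩
    rw [complexBetti_map_add_one]
    change (complexBetti.map (x • 𝟙 B : B ⟶ B).hom.hom.hom 1 + complexBetti.map Y.hom.hom.hom 1).hom (𝔅 (l, s)) = _
    rw [ModuleCat.hom_add, LinearMap.add_apply, complexBetti_map_nsmul_one, ModuleCat.hom_nsmul, LinearMap.smul_apply, hY𝔅]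
    change x • complexBetti.map (𝟙 B : B ⟶ B).hom.hom.hom 1 (𝔅 (l, s)) + _ = _
    rw [complexBetti_map_id_one_apply, add_smul, Nat.cast_smul_eq_nsmul]
  have hRBw : ∀ (r : Fin (2 * p + 1)) S, R r (Bw S) = qv r S • Bw S := by
    intro r S
    refine hReig r (Nat.le_of_lt_succ r.2) (Bw S) (MS S) (hMScard S) fun x => ?_
    rw [hBw _ _ (hGY x) S]
    simp only [MS, Multiset.map_map, Finset.prod_eq_multiset_prod, Function.comp_def]
  have hyDboth := masked_component_rational_hodge hB Bw (fun r : Fin (2 * p + 1) => R r) qv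
    (fun r c' hc' => hRrat r c' hc') (fun r p' q' c' hc' => hRhodge r p' q' c' hc') hRBw y
  have hyDrat : IsRationalClass yD := hyDboth.1 hyrat
  have hyDhodge : IsOfHodgeType B.dim B.X (2 * p) p p yD := hyDboth.2 p p hyhodge
  -- the key identity and the idempotent split
  have hkeyId : complexBetti.map ι₀.hom.hom.hom (2 * p) yD = (n : ℂ) • c :=
    andre_keyIdentity A B ι₀ πp Y v 𝔅 ρ Bw R hd hρinj hY𝔅 (fun l s => hι𝔅 l s) (fun l => hπ𝔅 l) hBw hReig hcrit c
  obtain ⟨hsplit, huu2, hcols⟩ := andre_idempotentSplit B Y 𝔅 ρ Bw e Nd u hd hNd hρinj hY𝔅 hBw hu𝔅 hcrit y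
  -- a generic CM endomorphism `V = X + t • Y`
  obtain ⟨tsh, htsh⟩ := exists_nat_injective_add_mul (fun i : Fin (2 * A.dim) × Fin n => μ i.1) (fun i => ρ i.2)
    (by
      intro i j hij
      by_cases h1 : i.1 = j.1
      · right
        intro h2
        exact hij (Prod.ext h1 (hρinj h2))
      · left
        exact fun h2 => h1 (hμinj h2))
  let val : Fin (2 * A.dim) × Fin n → ℂ := fun i => μ i.1 + (tsh : ℂ) * ρ i.2
  let V : B ⟶ B := X + tsh • Y
  have hV : ∀ l s, complexBetti.map V.hom.hom.hom 1 (𝔅 (l, s)) = val (l, s) • 𝔅 (l, s) := by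
    intro l s
    change complexBetti.map (X + tsh • Y).hom.hom.hom 1 (𝔅 (l, s)) = (μ l + (tsh : ℂ) * ρ s) • 𝔅 (l, s)
    rw [complexBetti_map_add_one]
    change (complexBetti.map X.hom.hom.hom 1 + complexBetti.map (tsh • Y : B ⟶ B).hom.hom.hom 1).hom (𝔅 (l, s)) = _
    rw [ModuleCat.hom_add, LinearMap.add_apply, complexBetti_map_nsmul_one, ModuleCat.hom_nsmul, LinearMap.smul_apply,
      hY𝔅, hX𝔅, add_smul, ← Nat.cast_smul_eq_nsmul ℂ, smul_smul]
  have huV : ∀ α, u α ≫ V = V ≫ u α := fun α => by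
    simp only [V, Preadditive.comp_add, Preadditive.add_comp, Preadditive.comp_nsmul, Preadditive.nsmul_comp, huX, huY]
  -- the targets, one for each `α` with `|α| = 2p`
  set T : Finset (Finset (Fin (2 * A.dim))) := (Finset.univ : Finset (Fin (2 * A.dim))).powersetCard (2 * p) with hT
  have hNdpow : ((Nd : ℂ) ^ (2 * p)) ≠ 0 := pow_ne_zero _ (Nat.cast_ne_zero.mpr hNd.ne')
  have hncast : (n : ℂ) ≠ 0 := Nat.cast_ne_zero.mpr hn.ne'
  have hTarget : ∀ α ∈ T, ∃ (ψ' : image (u α) ⟶ image (u α)) (t' : complexBetti (image (u α)).X (2 * p)),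
      IsCMSub[image (u α)] ∧ (∀ μ' ∈ Finset.univ.image ρ, μ'.im ≠ 0) ∧
      (⨆ μ' ∈ Finset.univ.image ρ, Module.End.eigenspace (complexBetti.map ψ'.hom.hom.hom 1).hom μ') = ⊤ ∧
      (∀ μ' ∈ Finset.univ.image ρ, Module.finrank ℂ (Module.End.eigenspace (complexBetti.map ψ'.hom.hom.hom 1).hom μ') = 2 * p) ∧
      IsRationalClass t' ∧ IsOfHodgeType (image (u α)).dim (image (u α)).X (2 * p) p p t' ∧
      t' ∈ (⨆ μ' ∈ Finset.univ.image ρ, pullbackEigenclasses (image (u α)) ψ' (2 * p)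
        (fun x y => ((x : ℂ) + (y : ℂ) * μ') ^ (2 * p))) ∧
      complexBetti.map (toImage (u α)).hom.hom.hom (2 * p) t' =
        (n : ℂ)⁻¹ • (((Nd : ℂ) ^ (2 * p))⁻¹ • complexBetti.map (u α).hom.hom.hom (2 * p) yD) := by
    intro α hα
    have hαcard : α.card = 2 * p := (Finset.mem_powersetCard.mp hα).2
    obtain ⟨ψ', hCMα, hnr, htop, hdims, hdesc⟩ := andre_target B (u α) Y V 𝔅 ρ val α e hd hNd hαcard hρinj hρim
      (huY α) (huV α) hY𝔅 hV (fun i j _ _ h => htsh h) (hu𝔅 α) (hudim α)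
    set wα : complexBetti B.X (2 * p) := ((Nd : ℂ) ^ (2 * p))⁻¹ • complexBetti.map (u α).hom.hom.hom (2 * p) yD with hwα
    have hwu : complexBetti.map (u α).hom.hom.hom (2 * p) wα = ((Nd : ℂ) ^ (2 * p)) • wα := by
      rw [hwα, map_smul, huu2 α, smul_comm]
    obtain ⟨w, hwsum, hweig⟩ := hcols α
    have hwαsum : wα = ∑ s, ((Nd : ℂ) ^ (2 * p))⁻¹ • w s := by
      rw [hwα, ← Finset.smul_sum, ← hwsum]
    have hweig' : ∀ (s : Fin n) (x y' : ℕ), complexBetti.map (x • 𝟙 B + y' • Y).hom.hom.hom (2 * p)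
        (((Nd : ℂ) ^ (2 * p))⁻¹ • w s) = (((x : ℂ) + (y' : ℂ) * ρ s) ^ (2 * p)) • (((Nd : ℂ) ^ (2 * p))⁻¹ • w s) := by
      intro s x y'
      rw [map_smul, hweig, smul_comm]
    have hwαhodge : IsOfHodgeType B.dim B.X (2 * p) p p wα :=
      IsOfHodgeType.smul (hyDhodge.map_of_isSmoothProjective hB hB _) _
    obtain ⟨t', hqt, htrat, hthodge, htmem⟩ := hdesc wα (fun s => ((Nd : ℂ) ^ (2 * p))⁻¹ • w s) hwu hwαsum hweig'
    have hcastNd : ((Nd : ℂ) ^ (2 * p))⁻¹ = ((((Nd : ℚ) ^ (2 * p))⁻¹ : ℚ) : ℂ) := by push_cast; rfl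
    have hcastn : (n : ℂ)⁻¹ = (((n : ℚ)⁻¹ : ℚ) : ℂ) := by push_cast; rfl
    have hwαrat : IsRationalClass wα := by
      rw [hwα, hcastNd]
      exact (hyDrat.pullback _).smul _
    refine ⟨ψ', (n : ℂ)⁻¹ • t', hCMα, hnr, htop, hdims, ?_, ?_, Submodule.smul_mem _ _ htmem, ?_⟩
    · rw [hcastn]; exact (htrat hwαrat).smul _
    · exact IsOfHodgeType.smul (hthodge p p hwαhodge) _
    · rw [map_smul, hqt]
  choose ψf tf hTprops using hTarget
  -- index by `Fin m`
  let en : Fin T.card ≃ {α // α ∈ T} := T.equivFin.symm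
  refine ⟨T.card, fun k => image (u (en k).1), fun k => ι₀ ≫ toImage (u (en k).1),
    fun k => ψf (en k).1 (en k).2, fun _ => Finset.univ.image ρ, fun k => tf (en k).1 (en k).2,
    fun k => (hTprops _ (en k).2).1, fun k => (hTprops _ (en k).2).2.1, fun k => (hTprops _ (en k).2).2.2.1,
    fun k => (hTprops _ (en k).2).2.2.2.1, fun k => (hTprops _ (en k).2).2.2.2.2.1,
    fun k => (hTprops _ (en k).2).2.2.2.2.2.1, fun k => (hTprops _ (en k).2).2.2.2.2.2.2.1, ?_⟩
  -- `c = Σ_k f_k^* t_k`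
  have hterm : ∀ k : Fin T.card, complexBetti.map (ι₀ ≫ toImage (u (en k).1)).hom.hom.hom (2 * p) (tf (en k).1 (en k).2) =
      (n : ℂ)⁻¹ • complexBetti.map ι₀.hom.hom.hom (2 * p)
        (((Nd : ℂ) ^ (2 * p))⁻¹ • complexBetti.map (u (en k).1).hom.hom.hom (2 * p) yD) := by
    intro k
    rw [complexBetti_map_comp_hom, CategoryTheory.comp_apply, (hTprops _ (en k).2).2.2.2.2.2.2.2, map_smul]
  simp_rw [hterm]
  rw [← Finset.smul_sum, ← map_sum]
  have hsum : ∑ k : Fin T.card, ((Nd : ℂ) ^ (2 * p))⁻¹ • complexBetti.map (u (en k).1).hom.hom.hom (2 * p) yD = yD := by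
    rw [Equiv.sum_comp en (fun x : {α // α ∈ T} => ((Nd : ℂ) ^ (2 * p))⁻¹ • complexBetti.map (u x.1).hom.hom.hom (2 * p) yD),
      Finset.sum_coe_sort T (fun α => ((Nd : ℂ) ^ (2 * p))⁻¹ • complexBetti.map (u α).hom.hom.hom (2 * p) yD)]
    exact hsplit
  rw [hsum, hkeyId, smul_smul, inv_mul_cancel₀ hncast, one_smul]

end Summit.HodgeConjecture.HodgeConjecture.Theorems.HodgeAbelianVarieties.CMPivotAndre

end
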